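import Literature.Geometry.Lorentzian.KerrConvergence

/-!
# Route StarvedNecks — crux `NecksCertify`, line `two-cap-focusing-ledger`: seam surgery, closure clauses

Helper file for the registered stub `stub_seamSurgery` (N2): the two closure clauses of the seamed
decomposition, with all charts and atlas clauses entering as hypotheses —

* `tube_closure` — `HonestCore`(3): the late tube portions `{t ≥ τ' + s, r ≤ ϱ(t − s)}` of the new
  hole chart have relatively closed image in `O` (A12 on the `Ψ'`-part; on the squashed far part
  the image is the flat chart's image of a closed set of flat-late collar points);
* `flat_closure` — `Seamed` S11: the closure of the flat chart's image of `{y⁰ ≥ τ'}` outside the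
  tubes adds only tube-wall points, charted by the re-gauged hole charts (continuity + A3);
* `stub_seamSurgery_wall` (registered helper sub-goal, anchor): sublevel sets `{f ≤ g}` of
  continuous functions on `E4` are closed.

References: Dafermos–Holzegel–Rodnianski–Taylor, arXiv:2104.08222, §1 (exterior region as the
domain of the charts).  Mathlib + `Literature.Geometry.Lorentzian.KerrConvergence`; no
definitions, no named facts.
-/

noncomputable section

open scoped Manifold ContDiff Topology ENNReal
open Filter Set Function Topology Literature.Geometry.Lorentzian

namespace Summit.FinalStateConjecture.FinalStateConjecture.Theorems.NecksCertifyTwoCap.Seam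

set_option linter.dupNamespace false

/-- Registered helper sub-goal `stub_seamSurgery_wall` of N2 (anchor of this file): sublevel sets of
pairs of continuous functions on `E4` are closed (the tube walls `{r = ρ′(y⁰)}` and the weak tube
conditions are closed conditions). [folklore] -/
theorem stub_seamSurgery_wall :
    ∀ (f g : E4 → ℝ), Continuous f → Continuous g → IsClosed {y : E4 | f y ≤ g y} :=
  fun _ _ hf hg ↦ isClosed_le hf hg

/-- **Relative closedness of the late tube portions of the new hole chart** (clause `HonestCore`(3)
of the seamed decomposition, one hole).  For `τ' > T` and a continuous radius profile `ϱ`, the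
`Gl`-image of `A = {t ≥ τ' + s, r ≤ ϱ(t − s)}` is relatively closed in `O`: on `{r ≤ b(t) − 1/10}`
the image is a `Ψ'`-tube portion (A12 with the continuous profile `min (ϱ(t − s)) (b(t) − 1/10)`);
on `{r ≥ b(t) − 1/10}` it is the flat chart's image of the CLOSED set of flat-late collar points
`G(A ∩ {r ≥ b − 1/10})` (explicitly described through the squash), whose closure stays in the
flat-late region by `HonestFar`(2) and is computed through the open embedding `Φ`.
DHRT arXiv:2104.08222, §1. [folklore] -/
theorem tube_closure {𝓢 : Spacetime.{0} 4} (Λ : lorentzGroup) (c : E4) (M a R₁ τ₁ s τf T : ℝ)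
    (hs : 0 ≤ s) (hτ : τf ≤ τ₁) (hT : τ₁ + 3 ≤ T)
    (hdomR : ∀ y : E4, R₁ + 4 < (boostedKerrBackground Λ c M a).radius y → y ∈ (boostedKerrBackground Λ c M a).domain)
    (hdompos : ∀ y : E4, y ∈ (boostedKerrBackground Λ c M a).domain → 0 < (boostedKerrBackground Λ c M a).radius y)
    (Rg : ℝ → ℝ) (hRg4 : ∀ t, R₁ + 4 ≤ Rg t)
    (b : ℝ → ℝ) (hbc : Continuous b) (hbRg : ∀ t, Rg t + 21 / 20 ≤ b t ∧ b t ≤ Rg t + 29 / 20)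
    (σ : ℝ → ℝ → ℝ) (G : E4 → E4) (hσ1 : ∀ t ρ, ρ ≤ b t → σ t ρ = ρ)
    (hσ2 : ∀ t, StrictMono (σ t)) (hσ3 : ∀ t ρ, σ t ρ < b t + 1 / 2)
    (hσ4 : ∀ t ρ, b t ≤ ρ → b t ≤ σ t ρ) (hσ6 : Continuous (fun p : ℝ × ℝ ↦ σ p.1 p.2))
    (hG1 : ∀ y, (boostedKerrBackground Λ c M a).time (G y) = (boostedKerrBackground Λ c M a).time y)
    (hG2 : ∀ y, 0 < (boostedKerrBackground Λ c M a).radius y → (boostedKerrBackground Λ c M a).radius (G y) = σ ((boostedKerrBackground Λ c M a).time y) ((boostedKerrBackground Λ c M a).radius y))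
    (hG3 : ∀ y, 0 < (boostedKerrBackground Λ c M a).radius y → (boostedKerrBackground Λ c M a).radius y ≤ b ((boostedKerrBackground Λ c M a).time y) → G y = y)
    (hG7 : ∀ z, R₁ + 4 < (boostedKerrBackground Λ c M a).radius z → (∃ ϱ, (boostedKerrBackground Λ c M a).radius z < σ ((boostedKerrBackground Λ c M a).time z) ϱ) →
      ∃ y, R₁ + 4 < (boostedKerrBackground Λ c M a).radius y ∧ (boostedKerrBackground Λ c M a).time y = (boostedKerrBackground Λ c M a).time z ∧ G y = z)
    (Ψ' Gl : (boostedKerrBackground Λ c M a).domain → 𝓢.carrier) (O : Set 𝓢.carrier)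
    (hA12 : ∀ (τ'' : ℝ) (ϱ' : ℝ → ℝ), Continuous ϱ' → τ₁ < τ'' → (∀ t, ϱ' t < Rg t + 2) →
      closure (Ψ' '' {x | τ'' ≤ (boostedKerrBackground Λ c M a).time x ∧ (boostedKerrBackground Λ c M a).radius x ≤ ϱ' ((boostedKerrBackground Λ c M a).time x)}) ∩ O ⊆
        Ψ' '' {x | τ'' ≤ (boostedKerrBackground Λ c M a).time x ∧ (boostedKerrBackground Λ c M a).radius x ≤ ϱ' ((boostedKerrBackground Λ c M a).time x)})
    (W₀ : TopologicalSpace.Opens E4) (Φ : W₀ → 𝓢.carrier) (P Q : E4 → Prop)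
    (hΦ2 : IsOpenEmbedding (Set.restrict {w : W₀ | τf < w.1 0} Φ))
    (hf2 : ∀ τ'' : ℝ, τf < τ'' → closure (Φ '' {y : W₀ | τ'' ≤ y.1 0 ∧ Q y.1}) ⊆ Φ '' {y : W₀ | τ'' ≤ y.1 0})
    (hPQ : ∀ y : E4, τ₁ ≤ y 0 → P y → Q y)
    (hA3 : ∀ (y : E4) (hy : y ∈ (boostedKerrBackground Λ c M a).domain), τ₁ ≤ y 0 → P y →
      (boostedKerrBackground Λ c M a).radius y ≤ Rg ((boostedKerrBackground Λ c M a).time y) + 2 → ∃ hw : y ∈ W₀, Ψ' ⟨y, hy⟩ = Φ ⟨y, hw⟩)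
    (hcollar : ∀ y : E4, y ∈ (boostedKerrBackground Λ c M a).domain → τ₁ + 1 + s < (boostedKerrBackground Λ c M a).time y →
      Rg ((boostedKerrBackground Λ c M a).time y) + 17 / 20 < (boostedKerrBackground Λ c M a).radius y → (boostedKerrBackground Λ c M a).radius y < Rg ((boostedKerrBackground Λ c M a).time y) + 2 →
      τ₁ ≤ y 0 ∧ τf < y 0 ∧ P y)
    (hlag : ∀ y : E4, τ₁ ≤ (boostedKerrBackground Λ c M a).time y → (boostedKerrBackground Λ c M a).radius y ≤ Rg ((boostedKerrBackground Λ c M a).time y) + 2 → (boostedKerrBackground Λ c M a).time y - s ≤ y 0)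
    (hGl2 : ∀ x : (boostedKerrBackground Λ c M a).domain, τ₁ + 2 + s ≤ (boostedKerrBackground Λ c M a).time x → (boostedKerrBackground Λ c M a).radius x < b ((boostedKerrBackground Λ c M a).time x) → Gl x = Ψ' x)
    (hGl3 : ∀ x : (boostedKerrBackground Λ c M a).domain, τ₁ + 2 + s ≤ (boostedKerrBackground Λ c M a).time x → b ((boostedKerrBackground Λ c M a).time x) ≤ (boostedKerrBackground Λ c M a).radius x →
      ∃ hw : G x ∈ W₀, Gl x = Φ ⟨G x, hw⟩ ∧ τf < G x 0)
    (τ' : ℝ) (ϱ : ℝ → ℝ) (hϱ : Continuous ϱ) (hτ' : T < τ') :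
    closure (Gl '' {x | τ' + s ≤ (boostedKerrBackground Λ c M a).time x ∧ (boostedKerrBackground Λ c M a).radius x ≤ ϱ ((boostedKerrBackground Λ c M a).time x - s)}) ∩ O ⊆
      Gl '' {x | τ' + s ≤ (boostedKerrBackground Λ c M a).time x ∧ (boostedKerrBackground Λ c M a).radius x ≤ ϱ ((boostedKerrBackground Λ c M a).time x - s)} := by
  have hTc : Continuous (boostedKerrBackground Λ c M a).time := (PiLp.continuous_apply 2 _ 0).comp (continuous_poincareInv Λ c)
  have hRc : Continuous (boostedKerrBackground Λ c M a).radius := (Kerr.continuous_radius a).comp (continuous_poincareInv Λ c)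
  have hb5 : ∀ t, R₁ + 5 ≤ b t := fun t ↦ by linarith [(hbRg t).1, hRg4 t]
  have hlateτ : τ₁ + 3 + s ≤ τ' + s := by linarith
  set A : Set (boostedKerrBackground Λ c M a).domain := {x | τ' + s ≤ (boostedKerrBackground Λ c M a).time x ∧ (boostedKerrBackground Λ c M a).radius x ≤ ϱ ((boostedKerrBackground Λ c M a).time x - s)} with hA
  set ϱ₁ : ℝ → ℝ := fun t ↦ min (ϱ (t - s)) (b t - 1 / 10) with hϱ₁
  set A₁ : Set (boostedKerrBackground Λ c M a).domain := {x | τ' + s ≤ (boostedKerrBackground Λ c M a).time x ∧ (boostedKerrBackground Λ c M a).radius x ≤ ϱ₁ ((boostedKerrBackground Λ c M a).time x)} with hA₁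
  set A₂ : Set (boostedKerrBackground Λ c M a).domain := {x | τ' + s ≤ (boostedKerrBackground Λ c M a).time x ∧ b ((boostedKerrBackground Λ c M a).time x) - 1 / 10 ≤ (boostedKerrBackground Λ c M a).radius x ∧
    (boostedKerrBackground Λ c M a).radius x ≤ ϱ ((boostedKerrBackground Λ c M a).time x - s)} with hA₂
  have hAsub : A ⊆ A₁ ∪ A₂ := by
    rintro x ⟨h1, h2⟩
    rcases le_or_gt ((boostedKerrBackground Λ c M a).radius x.1) (b ((boostedKerrBackground Λ c M a).time x.1) - 1 / 10) with h | h
    · exact Or.inl ⟨h1, le_min h2 h⟩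
    · exact Or.inr ⟨h1, h.le, h2⟩
  have hA₁sub : A₁ ⊆ A := fun x hx ↦ ⟨hx.1, hx.2.trans (min_le_left _ _)⟩
  have hA₂sub : A₂ ⊆ A := fun x hx ↦ ⟨hx.1, hx.2.2⟩
  -- (i) the `Ψ'`-part: A12
  have h1 : closure (Gl '' A₁) ∩ O ⊆ Gl '' A := by
    have heq : Gl '' A₁ = Ψ' '' A₁ := image_congr fun x hx ↦ hGl2 x (by linarith [hx.1])
      (hx.2.trans_lt ((min_le_right _ _).trans_lt (by linarith)))
    rw [heq]
    have hprof : Continuous ϱ₁ :=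
      (hϱ.comp (continuous_id.sub continuous_const)).min (hbc.sub continuous_const)
    have h12 := hA12 (τ' + s) ϱ₁ hprof (by linarith)
      (fun t ↦ (min_le_right _ _).trans_lt (by linarith [(hbRg t).2]))
    refine h12.trans ?_
    rw [← heq]
    exact image_mono hA₁sub
  -- (ii) the squashed part: the closed set of flat collar points
  set E₂ : Set E4 := {z | τ' + s ≤ (boostedKerrBackground Λ c M a).time z ∧ b ((boostedKerrBackground Λ c M a).time z) - 1 / 10 ≤ (boostedKerrBackground Λ c M a).radius z ∧
    (boostedKerrBackground Λ c M a).radius z ≤ σ ((boostedKerrBackground Λ c M a).time z) (ϱ ((boostedKerrBackground Λ c M a).time z - s)) ∧ b ((boostedKerrBackground Λ c M a).time z) - 1 / 10 ≤ ϱ ((boostedKerrBackground Λ c M a).time z - s)}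
    with hE₂
  have hE₂cl : IsClosed E₂ := by
    have hc1 : Continuous fun z : E4 ↦ b ((boostedKerrBackground Λ c M a).time z) - 1 / 10 := (hbc.comp hTc).sub continuous_const
    have hc2 : Continuous fun z : E4 ↦ ϱ ((boostedKerrBackground Λ c M a).time z - s) := hϱ.comp (hTc.sub continuous_const)
    have hc3 : Continuous fun z : E4 ↦ σ ((boostedKerrBackground Λ c M a).time z) (ϱ ((boostedKerrBackground Λ c M a).time z - s)) :=
      hσ6.comp (hTc.prodMk hc2)
    refine (isClosed_le continuous_const hTc).inter ((isClosed_le hc1 hRc).inter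
      ((isClosed_le hRc hc3).inter (isClosed_le hc1 hc2)))
  -- description of the squashed part through the squash
  have hGE : ∀ x : E4, x ∈ (boostedKerrBackground Λ c M a).domain → τ' + s ≤ (boostedKerrBackground Λ c M a).time x → b ((boostedKerrBackground Λ c M a).time x) - 1 / 10 ≤ (boostedKerrBackground Λ c M a).radius x →
      (boostedKerrBackground Λ c M a).radius x ≤ ϱ ((boostedKerrBackground Λ c M a).time x - s) → G x ∈ E₂ := by
    intro x hxd h1 h2 h3
    have hr0 : 0 < (boostedKerrBackground Λ c M a).radius x := hdompos x hxd
    refine ⟨by rw [hG1]; exact h1, ?_, ?_, by rw [hG1]; exact h2.trans h3⟩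
    · rw [hG1, hG2 x hr0]
      rcases le_or_gt ((boostedKerrBackground Λ c M a).radius x) (b ((boostedKerrBackground Λ c M a).time x)) with h | h
      · rw [hσ1 _ _ h]; exact h2
      · linarith [hσ4 _ _ h.le]
    · rw [hG1, hG2 x hr0]
      exact (hσ2 _).monotone h3
  have hEG : ∀ z ∈ E₂, ∃ x : E4, x ∈ (boostedKerrBackground Λ c M a).domain ∧ τ' + s ≤ (boostedKerrBackground Λ c M a).time x ∧
      b ((boostedKerrBackground Λ c M a).time x) - 1 / 10 ≤ (boostedKerrBackground Λ c M a).radius x ∧ (boostedKerrBackground Λ c M a).radius x ≤ ϱ ((boostedKerrBackground Λ c M a).time x - s) ∧ G x = z := by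
    rintro z ⟨h1, h2, h3, h4⟩
    have hzd : z ∈ (boostedKerrBackground Λ c M a).domain := hdomR z (by linarith [hb5 ((boostedKerrBackground Λ c M a).time z)])
    have hz0 : 0 < (boostedKerrBackground Λ c M a).radius z := hdompos z hzd
    rcases le_or_gt ((boostedKerrBackground Λ c M a).radius z) (b ((boostedKerrBackground Λ c M a).time z)) with h | h
    · refine ⟨z, hzd, h1, h2, ?_, hG3 z hz0 h⟩
      rcases le_or_gt (ϱ ((boostedKerrBackground Λ c M a).time z - s)) (b ((boostedKerrBackground Λ c M a).time z)) with h' | h'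
      · rw [hσ1 _ _ h'] at h3; exact h3
      · linarith
    · obtain ⟨y, hyr, hyt, hGy⟩ := hG7 z (by linarith [hb5 ((boostedKerrBackground Λ c M a).time z)])
        ⟨ϱ ((boostedKerrBackground Λ c M a).time z - s) + 1, h3.trans_lt (hσ2 _ (by linarith))⟩
      have hyd : y ∈ (boostedKerrBackground Λ c M a).domain := hdomR y hyr
      have hy0 : 0 < (boostedKerrBackground Λ c M a).radius y := hdompos y hyd
      have hGy' : (boostedKerrBackground Λ c M a).radius z = σ ((boostedKerrBackground Λ c M a).time z) ((boostedKerrBackground Λ c M a).radius y) := by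
        rw [← hGy, hG2 y hy0, hG1]
      refine ⟨y, hyd, by rw [hyt]; exact h1, ?_, ?_, hGy⟩
      · by_contra hcon
        push Not at hcon
        have hid := hG3 y hy0 (by linarith)
        rw [hid] at hGy
        subst hGy
        linarith
      · rw [hyt]
        exact ((hσ2 _).le_iff_le).mp (by rw [← hGy']; exact h3)
  -- the chart formula on `A₂` : `Gl x = Φ (G x)`, with `G x` a flat-late point satisfying `Q`
  have hform : ∀ x ∈ A₂, ∃ hw : G x.1 ∈ W₀, Gl x = Φ ⟨G x.1, hw⟩ ∧ τf < (G x.1) 0 ∧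
      τ' ≤ (G x.1) 0 ∧ Q (G x.1) := by
    rintro x ⟨h1, h2, h3⟩
    have hlate : τ₁ + 2 + s ≤ (boostedKerrBackground Λ c M a).time x.1 := by linarith
    have hb1 := (hbRg ((boostedKerrBackground Λ c M a).time x.1)).1
    have hb2 := (hbRg ((boostedKerrBackground Λ c M a).time x.1)).2
    rcases lt_or_ge ((boostedKerrBackground Λ c M a).radius x.1) (b ((boostedKerrBackground Λ c M a).time x.1)) with h | h
    · have hr0 : 0 < (boostedKerrBackground Λ c M a).radius x.1 := hdompos x.1 x.2
      have hGid : G x.1 = x.1 := hG3 x.1 hr0 h.le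
      obtain ⟨hx0, hxf, hPx⟩ := hcollar x.1 x.2 (by linarith) (by linarith) (by linarith)
      obtain ⟨hw, heq⟩ := hA3 x.1 x.2 hx0 hPx (by linarith)
      have hlg := hlag x.1 (by linarith) (by linarith)
      rw [hGid]
      exact ⟨hw, (hGl2 x hlate h).trans heq, hxf, by linarith, hPQ _ hx0 hPx⟩
    · obtain ⟨hw, hGl, hf⟩ := hGl3 x hlate h
      have hr0 : 0 < (boostedKerrBackground Λ c M a).radius x.1 := hdompos x.1 x.2
      have htz : (boostedKerrBackground Λ c M a).time (G x.1) = (boostedKerrBackground Λ c M a).time x.1 := hG1 x.1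
      have hrz : (boostedKerrBackground Λ c M a).radius (G x.1) = σ ((boostedKerrBackground Λ c M a).time x.1) ((boostedKerrBackground Λ c M a).radius x.1) := hG2 x.1 hr0
      have hrz1 : b ((boostedKerrBackground Λ c M a).time x.1) ≤ (boostedKerrBackground Λ c M a).radius (G x.1) := by rw [hrz]; exact hσ4 _ _ h
      have hrz2 : (boostedKerrBackground Λ c M a).radius (G x.1) < b ((boostedKerrBackground Λ c M a).time x.1) + 1 / 2 := by rw [hrz]; exact hσ3 _ _
      have hzd : G x.1 ∈ (boostedKerrBackground Λ c M a).domain := hdomR _ (by linarith [hb5 ((boostedKerrBackground Λ c M a).time x.1)])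
      obtain ⟨hz0, -, hPz⟩ := hcollar (G x.1) hzd (by rw [htz]; linarith) (by rw [htz]; linarith)
        (by rw [htz]; linarith)
      have hlg := hlag (G x.1) (by rw [htz]; linarith) (by rw [htz]; linarith)
      rw [htz] at hlg
      exact ⟨hw, hGl, hf, by linarith, hPQ _ hz0 hPz⟩
  have h2 : closure (Gl '' A₂) ∩ O ⊆ Gl '' A := by
    rintro q ⟨hq, -⟩
    -- `q = Φ w₁` with `w₁` flat-late, by `HonestFar`(2)
    have hsubF : Gl '' A₂ ⊆ Φ '' {y : W₀ | τ' ≤ y.1 0 ∧ Q y.1} := by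
      rintro _ ⟨x, hx, rfl⟩
      obtain ⟨hw, heq, -, h0, hQ⟩ := hform x hx
      exact ⟨⟨G x.1, hw⟩, ⟨h0, hQ⟩, heq.symm⟩
    obtain ⟨w₁, hw₁, hqw⟩ := hf2 τ' (by linarith) (closure_mono hsubF hq)
    have hw₁l : τf < w₁.1 0 := by have h := hw₁; simp only [mem_setOf_eq] at h; linarith
    -- pull the closure back through the embedding of the flat-late region
    set e : {w : W₀ | τf < w.1 0} → 𝓢.carrier := Set.restrict {w : W₀ | τf < w.1 0} Φ with he
    set S : Set {w : W₀ | τf < w.1 0} := {w | ((w : W₀) : E4) ∈ E₂} with hS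
    have hsubS : Gl '' A₂ ⊆ e '' S := by
      rintro _ ⟨x, hx, rfl⟩
      obtain ⟨hw, heq, hf, -, -⟩ := hform x hx
      exact ⟨⟨⟨G x.1, hw⟩, hf⟩, hGE x.1 x.2 hx.1 hx.2.1 hx.2.2, heq.symm⟩
    have hq' : e ⟨w₁, hw₁l⟩ ∈ closure (e '' S) := by
      have : e ⟨w₁, hw₁l⟩ = q := hqw
      rw [this]; exact closure_mono hsubS hq
    have hcl : (⟨w₁, hw₁l⟩ : {w : W₀ | τf < w.1 0}) ∈ closure S := by
      rw [hΦ2.isEmbedding.closure_eq_preimage_closure_image S]; exact hq'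
    have hcont : Continuous fun w : {w : W₀ | τf < w.1 0} ↦ ((w : W₀) : E4) :=
      continuous_subtype_val.comp continuous_subtype_val
    have hwE : (w₁ : E4) ∈ E₂ := by
      have h := hcont.closure_preimage_subset E₂ hcl
      rw [hE₂cl.closure_eq] at h
      exact h
    obtain ⟨x, hxd, hx1, hx2, hx3, hGx⟩ := hEG _ hwE
    obtain ⟨hw, heq, -, -, -⟩ := hform ⟨x, hxd⟩ ⟨hx1, hx2, hx3⟩
    refine ⟨⟨x, hxd⟩, hA₂sub ⟨hx1, hx2, hx3⟩, ?_⟩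
    rw [heq, ← hqw]
    show Φ _ = Φ _
    congr 1
    exact Subtype.ext hGx
  -- assemble
  rintro q ⟨hq, hqO⟩
  have hq' : q ∈ closure (Gl '' A₁ ∪ Gl '' A₂) :=
    closure_mono ((image_mono hAsub).trans (image_union _ _ _).le) hq
  rw [closure_union] at hq'
  rcases hq' with h | h
  · exact h1 ⟨h, hqO⟩
  · exact h2 ⟨h, hqO⟩



/-- **Closures of the flat-late regions of the seamed decomposition** (clause S11 of `Seamed`).
The closure of the flat chart's image of `{y⁰ ≥ τ', outside all tubes}` (`τ' > T`) consists of
such points and of points ON a tube wall `{rⱼ = ρ′ⱼ(y⁰)}`, the latter charted by the re-gauged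
chart `Ψ'ⱼ` (which is continuous there and agrees with `Φ` on the approximating flat points, A3):
limits stay flat-late by `HonestFar`(2) and are computed through the open embedding `Φ`.
DHRT arXiv:2104.08222, §1. [folklore] -/
theorem flat_closure {𝓢 : Spacetime.{0} 4} (N : ℕ) (Λ : Fin N → lorentzGroup) (c : Fin N → E4)
    (M a : Fin N → ℝ) (R₁ τ₁ τf T : ℝ) (s : Fin N → ℝ) (hs : ∀ j, 0 ≤ s j) (hτ : τf ≤ τ₁)
    (hT : τ₁ + 3 ≤ T) (hdom1 : ∀ j (y : E4), R₁ + 1 ≤ (boostedKerrBackground (Λ j) (c j) (M j) (a j)).radius y → y ∈ (boostedKerrBackground (Λ j) (c j) (M j) (a j)).domain)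
    (Rg : Fin N → ℝ → ℝ) (hRgc : ∀ j, Continuous (Rg j))
    (ρ' : Fin N → ℝ → ℝ) (hρ'c : ∀ j, Continuous (ρ' j)) (hρ'1 : ∀ j t, R₁ + 1 ≤ ρ' j t)
    (Ψ' : ∀ j, (boostedKerrBackground (Λ j) (c j) (M j) (a j)).domain → 𝓢.carrier)
    (hA1a : ∀ j, ContMDiffOn 𝓘(ℝ, E4) (𝓡 4) ∞ (Ψ' j)
      {x | τ₁ < (boostedKerrBackground (Λ j) (c j) (M j) (a j)).time x ∧ (boostedKerrBackground (Λ j) (c j) (M j) (a j)).radius x < Rg j ((boostedKerrBackground (Λ j) (c j) (M j) (a j)).time x) + 2})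
    (W₀ : TopologicalSpace.Opens E4) (Φ : W₀ → 𝓢.carrier) (Q : E4 → Prop)
    (hΦ2 : IsOpenEmbedding (Set.restrict {w : W₀ | τf < w.1 0} Φ))
    (hf2 : ∀ τ'' : ℝ, τf < τ'' →
      closure (Φ '' {y : W₀ | τ'' ≤ y.1 0 ∧ Q y.1}) ⊆ Φ '' {y : W₀ | τ'' ≤ y.1 0})
    (hPQ : ∀ y : E4, τ₁ ≤ y 0 → (∀ j, ρ' j (y 0) < (boostedKerrBackground (Λ j) (c j) (M j) (a j)).radius y) → Q y)
    (hA3 : ∀ j (y : E4) (hy : y ∈ (boostedKerrBackground (Λ j) (c j) (M j) (a j)).domain), τ₁ ≤ y 0 → (∀ j, ρ' j (y 0) < (boostedKerrBackground (Λ j) (c j) (M j) (a j)).radius y) →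
      (boostedKerrBackground (Λ j) (c j) (M j) (a j)).radius y ≤ Rg j ((boostedKerrBackground (Λ j) (c j) (M j) (a j)).time y) + 2 → ∃ hw : y ∈ W₀, Ψ' j ⟨y, hy⟩ = Φ ⟨y, hw⟩)
    (hA5 : ∀ j (y : E4), τ₁ ≤ y 0 → (boostedKerrBackground (Λ j) (c j) (M j) (a j)).radius y ≤ ρ' j (y 0) → (boostedKerrBackground (Λ j) (c j) (M j) (a j)).radius y + 3 ≤ Rg j ((boostedKerrBackground (Λ j) (c j) (M j) (a j)).time y))
    (hY : ∀ j (y : E4), T < y 0 → (boostedKerrBackground (Λ j) (c j) (M j) (a j)).radius y ≤ Rg j ((boostedKerrBackground (Λ j) (c j) (M j) (a j)).time y) + 2 → τ₁ + 3 ≤ (boostedKerrBackground (Λ j) (c j) (M j) (a j)).time y - s j)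
    (τ' : ℝ) (hτ' : T < τ') :
    closure (Φ '' {y : W₀ | τ' ≤ y.1 0 ∧ ∀ j, ρ' j (y.1 0) < (boostedKerrBackground (Λ j) (c j) (M j) (a j)).radius y.1}) ⊆
      Φ '' {y : W₀ | τ' ≤ y.1 0 ∧ ∀ j, ρ' j (y.1 0) < (boostedKerrBackground (Λ j) (c j) (M j) (a j)).radius y.1} ∪
      ⋃ j, Ψ' j '' {x | τ' ≤ x.1 0 ∧ (boostedKerrBackground (Λ j) (c j) (M j) (a j)).radius x = ρ' j (x.1 0) ∧ τ₁ + 3 + s j ≤ (boostedKerrBackground (Λ j) (c j) (M j) (a j)).time x ∧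
        (boostedKerrBackground (Λ j) (c j) (M j) (a j)).radius x + 3 ≤ Rg j ((boostedKerrBackground (Λ j) (c j) (M j) (a j)).time x)} := by
  intro q hq
  have hTc : ∀ j, Continuous (boostedKerrBackground (Λ j) (c j) (M j) (a j)).time := fun j ↦
    (PiLp.continuous_apply 2 _ 0).comp (continuous_poincareInv (Λ j) (c j))
  have hRc : ∀ j, Continuous (boostedKerrBackground (Λ j) (c j) (M j) (a j)).radius := fun j ↦
    (Kerr.continuous_radius (a j)).comp (continuous_poincareInv (Λ j) (c j))
  -- the limit is a flat-late point `w₁`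
  have hsubF : Φ '' {y : W₀ | τ' ≤ y.1 0 ∧ ∀ j, ρ' j (y.1 0) < (boostedKerrBackground (Λ j) (c j) (M j) (a j)).radius y.1} ⊆
      Φ '' {y : W₀ | τ' ≤ y.1 0 ∧ Q y.1} :=
    image_mono fun y hy ↦ ⟨hy.1, hPQ _ (by linarith [hy.1]) hy.2⟩
  obtain ⟨w₁, hw₁, hqw⟩ := hf2 τ' (by linarith) (closure_mono hsubF hq)
  have hw₁τ : τ' ≤ w₁.1 0 := hw₁
  have hw₁l : τf < w₁.1 0 := by linarith
  -- pull the closure back through the embedding of the flat-late region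
  set Lf : Set W₀ := {w : W₀ | τf < w.1 0} with hLf
  set e : Lf → 𝓢.carrier := Set.restrict Lf Φ with he
  set S : Set Lf := {w | τ' ≤ (w : W₀).1 0 ∧ ∀ j, ρ' j ((w : W₀).1 0) < (boostedKerrBackground (Λ j) (c j) (M j) (a j)).radius (w : W₀).1}
    with hS
  have hsubS : Φ '' {y : W₀ | τ' ≤ y.1 0 ∧ ∀ j, ρ' j (y.1 0) < (boostedKerrBackground (Λ j) (c j) (M j) (a j)).radius y.1} ⊆ e '' S := by
    rintro _ ⟨y, hy, rfl⟩
    exact ⟨⟨y, by show τf < y.1 0; linarith [hy.1]⟩, hy, rfl⟩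
  have hcl : (⟨w₁, hw₁l⟩ : Lf) ∈ closure S := by
    rw [hΦ2.isEmbedding.closure_eq_preimage_closure_image S]
    show e ⟨w₁, hw₁l⟩ ∈ closure (e '' S)
    have : e ⟨w₁, hw₁l⟩ = q := hqw
    rw [this]; exact closure_mono hsubS hq
  have hcont : Continuous fun w : Lf ↦ ((w : W₀) : E4) :=
    continuous_subtype_val.comp continuous_subtype_val
  -- on the closure the strict tube inequalities become weak ones
  have hweak : ∀ j, ρ' j (w₁.1 0) ≤ (boostedKerrBackground (Λ j) (c j) (M j) (a j)).radius w₁.1 := by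
    intro j
    have hC : IsClosed {w : Lf | ρ' j (((w : W₀) : E4) 0) ≤ (boostedKerrBackground (Λ j) (c j) (M j) (a j)).radius ((w : W₀) : E4)} :=
      isClosed_le ((hρ'c j).comp ((PiLp.continuous_apply 2 _ 0).comp hcont)) ((hRc j).comp hcont)
    exact (hC.closure_subset_iff.mpr fun w hw ↦ (hw.2 j).le) hcl
  by_cases hall : ∀ j, ρ' j (w₁.1 0) < (boostedKerrBackground (Λ j) (c j) (M j) (a j)).radius w₁.1
  · exact Or.inl ⟨w₁, ⟨hw₁τ, hall⟩, hqw⟩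
  · push Not at hall
    obtain ⟨j, hj⟩ := hall
    have heq : (boostedKerrBackground (Λ j) (c j) (M j) (a j)).radius w₁.1 = ρ' j (w₁.1 0) := le_antisymm hj (hweak j)
    have hw0 : τ₁ ≤ w₁.1 0 := by linarith
    have hxd : (w₁.1 : E4) ∈ (boostedKerrBackground (Λ j) (c j) (M j) (a j)).domain := hdom1 j _ (by rw [heq]; exact hρ'1 j _)
    have h5 := hA5 j w₁.1 hw0 hj
    have hYw := hY j w₁.1 (by linarith) (by linarith)
    refine Or.inr (mem_iUnion.mpr ⟨j, ⟨w₁.1, hxd⟩, ⟨hw₁τ, heq, by linarith, h5⟩, ?_⟩)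
    -- `Ψ' j w₁ = q` by continuity along flat points of `S` approaching `w₁`
    set x₁ : (boostedKerrBackground (Λ j) (c j) (M j) (a j)).domain := ⟨w₁.1, hxd⟩ with hx₁
    set U : Set (boostedKerrBackground (Λ j) (c j) (M j) (a j)).domain := {x | τ₁ < (boostedKerrBackground (Λ j) (c j) (M j) (a j)).time x ∧ (boostedKerrBackground (Λ j) (c j) (M j) (a j)).radius x < Rg j ((boostedKerrBackground (Λ j) (c j) (M j) (a j)).time x) + 2} with hU
    have hUo : IsOpen U := (isOpen_lt continuous_const ((hTc j).comp continuous_subtype_val)).inter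
      (isOpen_lt ((hRc j).comp continuous_subtype_val)
        ((((hRgc j).comp (hTc j)).comp continuous_subtype_val).add continuous_const))
    have hx₁U : x₁ ∈ U := ⟨by show τ₁ < (boostedKerrBackground (Λ j) (c j) (M j) (a j)).time w₁.1; linarith [hYw, hs j],
      by show (boostedKerrBackground (Λ j) (c j) (M j) (a j)).radius w₁.1 < _; linarith⟩
    have hΨc : ContinuousAt (Ψ' j) x₁ := ((hA1a j).continuousOn.continuousWithinAt hx₁U).continuousAt
      (hUo.mem_nhds hx₁U)
    -- extension of `Ψ' j` to `E4` (junk value `q` off the domain)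
    classical
    set Ψe : E4 → 𝓢.carrier := fun y ↦ if h : y ∈ (boostedKerrBackground (Λ j) (c j) (M j) (a j)).domain then Ψ' j ⟨y, h⟩ else q with hΨe
    have hΨe_dom : ∀ (y : E4) (h : y ∈ (boostedKerrBackground (Λ j) (c j) (M j) (a j)).domain), Ψe y = Ψ' j ⟨y, h⟩ := fun y h ↦ dif_pos h
    have hΨec : Tendsto Ψe (𝓝 (w₁.1 : E4)) (𝓝 (Ψ' j x₁)) := by
      have hmap : map (Subtype.val : (boostedKerrBackground (Λ j) (c j) (M j) (a j)).domain → E4) (𝓝 x₁) = 𝓝 (w₁.1 : E4) :=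
        map_nhds_subtype_coe_eq_nhds hxd ((boostedKerrBackground (Λ j) (c j) (M j) (a j)).domain.isOpen.mem_nhds hxd)
      rw [← hmap, tendsto_map'_iff]
      have : Ψe ∘ (Subtype.val : (boostedKerrBackground (Λ j) (c j) (M j) (a j)).domain → E4) = Ψ' j := by
        funext y; exact hΨe_dom y.1 y.2
      rw [this]; exact hΨc
    -- a sequence of points of `S` converging to `w₁`
    obtain ⟨u, huS, hu⟩ := mem_closure_iff_seq_limit.mp hcl
    have hv : Tendsto (fun n ↦ ((u n : W₀) : E4)) atTop (𝓝 (w₁.1 : E4)) :=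
      (hcont.tendsto _).comp hu
    have heu : Tendsto (fun n ↦ e (u n)) atTop (𝓝 q) := by
      rw [← hqw]; exact (hΦ2.continuous.tendsto _).comp hu
    have hΨu : Tendsto (fun n ↦ Ψe ((u n : W₀) : E4)) atTop (𝓝 (Ψ' j x₁)) := hΨec.comp hv
    -- eventually the two sequences agree (A3 near `w₁`)
    have hN : IsOpen {y : E4 | y ∈ (boostedKerrBackground (Λ j) (c j) (M j) (a j)).domain ∧ (boostedKerrBackground (Λ j) (c j) (M j) (a j)).radius y < Rg j ((boostedKerrBackground (Λ j) (c j) (M j) (a j)).time y) + 2} :=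
      (boostedKerrBackground (Λ j) (c j) (M j) (a j)).domain.isOpen.inter (isOpen_lt (hRc j) (((hRgc j).comp (hTc j)).add continuous_const))
    have hwN : (w₁.1 : E4) ∈ {y : E4 | y ∈ (boostedKerrBackground (Λ j) (c j) (M j) (a j)).domain ∧ (boostedKerrBackground (Λ j) (c j) (M j) (a j)).radius y < Rg j ((boostedKerrBackground (Λ j) (c j) (M j) (a j)).time y) + 2} :=
      ⟨hxd, by linarith⟩
    have hev : ∀ᶠ n in atTop, Ψe ((u n : W₀) : E4) = e (u n) := by
      filter_upwards [hv.eventually (hN.mem_nhds hwN)] with n hn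
      obtain ⟨hnd, hnr⟩ := hn
      obtain ⟨hw, hA⟩ := hA3 j _ hnd (by linarith [(huS n).1]) (huS n).2 hnr.le
      rw [hΨe_dom _ hnd, hA]
      rfl
    have hlim : Tendsto (fun n ↦ e (u n)) atTop (𝓝 (Ψ' j x₁)) := hΨu.congr' hev
    exact (tendsto_nhds_unique hlim heu)


end Summit.FinalStateConjecture.FinalStateConjecture.Theorems.NecksCertifyTwoCap.Seam

end
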